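import Summits.HubbardSuperconductivity.HubbardSuperconductivity.Theorems.AnisotropyChordTransferFibre3N1RowCellSound

/-!
# Route `AnisotropyChord` / H0 rotor rung, LEVEL 2 row `N₁`: the COVER LEMMAS for assembling certified `(ν, a)`-cells

The ∀L ≥ 128 certificate of the (KT-1″) trial-gap bound is a union of kernel-certified cells `[ν₁, ν₂] × [a₁, a₂]` (files
`…N1RowL2N…A….lean`, each `trialGap_cell… : cmin·U ≤ N₁`).  To assemble them along a `ν`-column and over the region one needs:
* ★ `a_le_AbarQ`: for every `L ≥ 128` and ground profile, `a = Δf(x̂) ≤ (16384/16383)·(1 − q₁ν − q₂ν²)` with the RATIONAL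
  constants `q₁ = 32.286 ≤ 2π·4.852 + 4π²·0.0456`, `q₂ = 4.9979 ≤ 4π²·0.1266` (`ν = λ₂/θ²`) — the `L`-uniform outer edge of the
  manifold band (`ManifoldA.manifold_band` at its widest, `L = 128`: `ln L ≥ 4.852`, `π ≥ 3.141592`); so a column whose `a`-cells
  reach `amax ≥ AbarQ(ν₁)` covers every ground profile of the column (`AbarQ` is decreasing);
* `a_nonneg'`, `nu_pos`, `nu_lt` (the other three sides: `0 ≤ a`, `0 < ν < 0.031`);
* ★ `trialGap_mono`: a certified constant may be lowered (`U ≥ 0`), so a column / region carries the minimum of its cells' `cmin`;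
* ★ `trialGap_glue`: two certificates on `a ≤ m` and `m ≤ a` give one on the union (the case split used by the generated column files).
Prover seat `hubbard-h0-rotor-p2` g5; helper for piece A = stmt-HubbardSuperconductivity-23918 of rung 19089
(`--supports`, helper class).  Nothing here proves superconductivity in the Hubbard model; helper lemmas of ONE conditional
reduction (the GM₃ ∀L certificate, Level-2 row `N₁`); the rotor TARGET as originally worded stays FALSE (g15 verdict).
Mathlib + the tree only; no sorry.
-/

set_option linter.dupNamespace false
set_option autoImplicit false

open Literature.Analysis.ValidatedNumerics

namespace Summit.HubbardSuperconductivity.HubbardSuperconductivity.Theorems.AnisotropyChord.Transfer.Fibre3.L2.N1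

variable (L : ℕ) [NeZero L]

/-- the rational outer edge of the manifold band: `AbarQ(ν) = (16384/16383)(1 − q₁ν − q₂ν²)`. -/
def AbarQ (ν : ℚ) : ℚ := 16384 / 16383 * (1 - 16143 / 500 * ν - 49979 / 10000 * ν ^ 2)

/-- the same function over `ℝ` (`q₁ = 16143/500 = 32.286 ≤ 2π·4.852 + 4π²·0.0456`, `q₂ = 49979/10000 ≤ 4π²·0.1266`). -/
theorem AbarQ_cast (ν : ℚ) : ((AbarQ ν : ℚ) : ℝ)
    = 16384 / 16383 * (1 - 16143 / 500 * (ν : ℝ) - 49979 / 10000 * (ν : ℝ) ^ 2) := by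
  unfold AbarQ; push_cast; ring

/-- ★ the `L`-uniform outer edge: `a ≤ (16384/16383)(1 − q₁ν − q₂ν²)` for every ground profile, `L ≥ 128`, `0 ≤ Δ < 1`. -/
theorem a_le_AbarQ (hL : 128 ≤ L) {Δ lam2 : ℝ} (hΔ0 : 0 ≤ Δ) (hΔ1 : Δ < 1) {f : Tor L → ℝ} (hf : IsGroundTwoMagnon L Δ lam2 f) :
    Δ * f (K1 L) ≤ 16384 / 16383 * (1 - 16143 / 500 * (lam2 / (2 * Real.pi / L) ^ 2)
      - 49979 / 10000 * (lam2 / (2 * Real.pi / L) ^ 2) ^ 2) := by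
  obtain ⟨ha0, _, _, hband⟩ := ManifoldA.manifold_band L hL hΔ0 hΔ1 hf
  obtain ⟨_, _, _, _, _, _, d7⟩ := ManifoldA.manifold_dictionary L (by omega) hΔ0 hΔ1 hf
  set a := Δ * f (K1 L) with ha
  set ν := lam2 / (2 * Real.pi / L) ^ 2 with hν
  set V : ℝ := (L : ℝ) ^ 2 with hV
  have hLR : (128 : ℝ) ≤ L := by exact_mod_cast hL
  have hV1 : (16384 : ℝ) ≤ V := by rw [hV]; nlinarith only [hLR]
  have hπlo : (3.141592 : ℝ) < Real.pi := Real.pi_gt_d6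
  have hπ := Real.pi_pos
  have hlam : 0 < lam2 := lam2_pos L (by omega) hΔ1 hf.1
  have hLpos : (0 : ℝ) < L := by linarith
  have hν0 : 0 < ν := by rw [hν]; positivity
  have hlog : (4.852 : ℝ) ≤ Real.log L :=
    ManifoldA.log_128_ge.trans (Real.log_le_log (by norm_num) hLR)
  -- the band's right side is at most `V·R0(ν)` with the rational-coefficient `R0`
  set g : ℝ := Real.log L / (2 * Real.pi) + 0.0456 + 0.1266 * ν with hg
  have hη : etaEff L lam2 = Real.pi ^ 2 * ν := by rw [d7]
  have hg0 : 4.852 / (2 * Real.pi) + 0.0456 + 0.1266 * ν ≤ g := by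
    have := div_le_div_of_nonneg_right hlog (by positivity : (0 : ℝ) ≤ 2 * Real.pi)
    rw [hg]; linarith only [this]
  have hkey : 4 * (Real.pi ^ 2 * ν) * g ≥ 16143 / 500 * ν + 49979 / 10000 * ν ^ 2 := by
    have h1 : 4 * (Real.pi ^ 2 * ν) * g ≥ 4 * (Real.pi ^ 2 * ν) * (4.852 / (2 * Real.pi) + 0.0456 + 0.1266 * ν) :=
      mul_le_mul_of_nonneg_left hg0 (by positivity)
    have h2 : 4 * (Real.pi ^ 2 * ν) * (4.852 / (2 * Real.pi) + 0.0456 + 0.1266 * ν)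
        = 2 * Real.pi * 4.852 * ν + 4 * Real.pi ^ 2 * 0.0456 * ν + 4 * Real.pi ^ 2 * 0.1266 * ν ^ 2 := by
      field_simp; ring
    rw [h2] at h1
    have hπ2 : (3.141592 : ℝ) ^ 2 ≤ Real.pi ^ 2 := by nlinarith only [hπlo]
    have hA : (16143 / 500 : ℝ) ≤ 2 * Real.pi * 4.852 + 4 * Real.pi ^ 2 * 0.0456 := by nlinarith only [hπlo, hπ2]
    have hB : (49979 / 10000 : ℝ) ≤ 4 * Real.pi ^ 2 * 0.1266 := by nlinarith only [hπ2]
    have hA' := mul_le_mul_of_nonneg_right hA hν0.le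
    have hB' := mul_le_mul_of_nonneg_right hB (sq_nonneg ν)
    linarith only [h1, hA', hB']
  set R : ℝ := 1 - 16143 / 500 * ν - 49979 / 10000 * ν ^ 2 with hR
  have hb : a * (V - 1) ≤ V * R := by
    rw [hη] at hband
    have : V * (1 - 4 * (Real.pi ^ 2 * ν) * g) ≤ V * R := by
      apply mul_le_mul_of_nonneg_left _ (by positivity); rw [hR]; linarith only [hkey]
    exact hband.trans this
  have hV0 : 0 < V - 1 := by linarith only [hV1]
  by_cases hR0 : 0 ≤ R
  · -- `a ≤ V/(V−1)·R ≤ (16384/16383)·R`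
    have hRV : 0 ≤ R * (V - 16384) := mul_nonneg hR0 (by linarith only [hV1])
    have h1 : a * (V - 1) ≤ (16384 / 16383 * R) * (V - 1) := by
      have : V * R ≤ 16384 / 16383 * R * (V - 1) := by linarith only [hRV]
      linarith only [this, hb]
    exact le_of_mul_le_mul_right h1 hV0
  · push Not at hR0
    have hneg : V * R < 0 := mul_neg_of_pos_of_neg (by linarith only [hV1]) hR0
    have h3 : a * (V - 1) < 0 := lt_of_le_of_lt hb hneg
    have h4 : 0 ≤ a * (V - 1) := mul_nonneg ha0 hV0.le
    linarith only [h3, h4]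

/-- the three other sides of the region: `0 ≤ a`, `0 < ν`, `ν < 0.031`. -/
theorem region_sides (hL : 128 ≤ L) {Δ lam2 : ℝ} (hΔ0 : 0 ≤ Δ) (hΔ1 : Δ < 1) {f : Tor L → ℝ} (hf : IsGroundTwoMagnon L Δ lam2 f) :
    0 ≤ Δ * f (K1 L) ∧ 0 < lam2 / (2 * Real.pi / L) ^ 2 ∧ lam2 / (2 * Real.pi / L) ^ 2 < 0.031 := by
  have hLpos : (0 : ℝ) < L := by exact_mod_cast (show 0 < L by omega)
  have ht : 0 < (2 * Real.pi / (L : ℝ)) ^ 2 := by positivity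
  refine ⟨(ManifoldA.manifold_band L hL hΔ0 hΔ1 hf).1, div_pos (lam2_pos L (by omega) hΔ1 hf.1) ht, ?_⟩
  rw [div_lt_iff₀ ht]
  exact ManifoldA.nu_ceiling L hL hΔ0 hf

/-- ★ lowering a certified constant (`U ≥ 0`). -/
theorem trialGap_mono {Δ lam2 : ℝ} (hΔ1 : Δ ≤ 1) {f : Tor L → ℝ} (hf : IsGroundTwoMagnon L Δ lam2 f) (hL : 2 ≤ L)
    {c c' : ℝ} (hcc : c' ≤ c) (h : c * Uunit L Δ f ≤ trialGapN1 L Δ f) : c' * Uunit L Δ f ≤ trialGapN1 L Δ f := by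
  have hU : 0 ≤ Uunit L Δ f := by
    unfold Uunit; exact mul_nonneg (by positivity) (Tplus_nonneg L hL hΔ1 hf)
  nlinarith

/-- ★ glueing two `a`-ranges at `m`. -/
theorem trialGap_glue {Δ : ℝ} {f : Tor L → ℝ} {c m : ℝ}
    (h1 : Δ * f (K1 L) ≤ m → c * Uunit L Δ f ≤ trialGapN1 L Δ f)
    (h2 : m ≤ Δ * f (K1 L) → c * Uunit L Δ f ≤ trialGapN1 L Δ f) : c * Uunit L Δ f ≤ trialGapN1 L Δ f := by
  rcases le_total (Δ * f (K1 L)) m with h | h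
  · exact h1 h
  · exact h2 h

end Summit.HubbardSuperconductivity.HubbardSuperconductivity.Theorems.AnisotropyChord.Transfer.Fibre3.L2.N1
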